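import Literature.Analysis.Complex.PQPullback
import Literature.Analysis.Complex.PQExhaustion
import Mathlib.Geometry.Manifold.PartitionOfUnity
import Mathlib.Topology.MetricSpace.Thickening
import Mathlib.Analysis.Normed.Module.Ball.Pointwise
import HarnessLib

/-!
# Oka's lemma: `∂̄`-solvability near analytic polyhedra (Hörmander, Lemma 2.7.5 / Thm. 2.7.6 (a))

An **analytic polyhedron** of `ℂ^ι` is here a compact set of the form

  `K = {z ∈ Δ̄(c,r) : |P_j(z)| ≤ 1, j < m}`      (`analyticPolyhedron c r P`)

with `Δ̄(c,r) = ∏ closedBall (c i) (r i)` a closed polydisc and `P_j : ℂ^ι → ℂ` entire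
functions (Hörmander (1973) takes polynomials, for polynomially convex compacta; the argument uses
only that the `P_j` are analytic near `Δ̄`, cf. the remark before Thm. 2.7.3, and for convex
compacta one takes `P_j = exp ∘ ℓ_j` with `ℓ_j` complex-affine).

**Theorem** (`exists_dbar_potential_nhds_analyticPolyhedron`, Hörmander (1973), Thm. 2.7.6 (a)
via Lemma 2.7.5, in the flat `(p,q)`-calculus of `Literature/Analysis/Complex/PQ*.lean`). If
`f : ℂ^ι → Λ^{n+1}` is `C^∞` on an open `U ⊇ K`, of type `(p,q+1)` on `U`, with
`(df)^{p,q+2} = 0` (`∂̄f = 0`) on `U`, then there are an open `U'` with `K ⊆ U' ⊆ U` and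
`u : ℂ^ι → Λ^n`, `C^∞` on `U'`, fixed by the `(p,q)`-projection, with `(du)^{p,q+1} = f`
(`∂̄u = f`) on `U'`.

The proof is Oka's induction on the number `m` of functions, through `ℂ^{ι ⊕ 1} = ℂ^{Option ι}`:
for `m = 0` this is the polydisc lemma (Hörmander Thm. 2.3.3,
`Literature.Analysis.Complex.exists_dbar_potential_of_type`) on a slightly larger open polydisc;
for `m + 1` functions, with `P = P_m` the last one, `K' ⊇ K` the polyhedron of the first `m`
functions and `K₊ = K' × D̄ ⊆ ℂ^{Option ι}` (again an analytic polyhedron with `m` functions), one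
cuts `f` off to `F₁ = χ f` (`χ = 1` near `K`, `supp χ ⊆ U`), sets `G = ∂̄F₁` (zero near `K`) and

  `g(z,w) = (P(z) - w)⁻¹ G(z)`   on   `W = {z near K} ∪ {|w| < |P(z)|} ⊇ K₊`,

a `∂̄`-closed `(p,q+2)`-form near `K₊`; the induction hypothesis (one bidegree up, in
`ℂ^{Option ι}`) gives `v` with `∂̄v = g` near `K₊`, so `F₂ = π^*F₁ - (P(z) - w) v` is `∂̄`-closed
near `K₊`; the induction hypothesis again gives `V` with `∂̄V = F₂` near `K₊`, and the pull-back
`u = Φ^*V` along the holomorphic graph map `Φ(z) = (z, P(z))` solves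
`∂̄u = Φ^*F₂ = Φ^*π^*F₁ - 0 = F₁ = f` near `K` (`Literature/Analysis/Complex/PQPullback.lean`).
A cut-off then gives a global `C^∞` potential with `∂̄u = f` near `K`
(`exists_dbar_potential_nhdsSet_analyticPolyhedron`).

## References

* L. Hörmander, *An Introduction to Complex Analysis in Several Variables*, 2nd ed. (1973),
  Lemma 2.7.5, Thm. 2.7.6, Thm. 2.3.3. [HormanderSCV1973]
-/

noncomputable section

open scoped ContDiff Topology Manifold
open Complex Function Set Filter Metric ContinuousAlternatingMap
open Literature.LinearAlgebra.Alternating Literature.NumberTheory.Transcendental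

namespace Literature.Analysis.Complex

universe u

section Defs

variable {ι : Type*}

/-! ### Closed polydiscs and analytic polyhedra -/

/-- The closed polydisc `Δ̄(c,r) = ∏_i closedBall (c i) (r i)` of `ℂ^ι`. [folklore] -/
def closedPolydisc (c : ι → ℂ) (r : ι → ℝ) : Set (ι → ℂ) :=
  Set.pi univ fun i => closedBall (c i) (r i)

/-- Membership in a closed polydisc. [folklore] -/
theorem mem_closedPolydisc {c : ι → ℂ} {r : ι → ℝ} {z : ι → ℂ} :
    z ∈ closedPolydisc c r ↔ ∀ i, ‖z i - c i‖ ≤ r i := by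
  simp [closedPolydisc, Set.mem_pi, mem_closedBall, dist_eq_norm]

/-- Closed polydiscs are compact. [folklore] -/
theorem isCompact_closedPolydisc (c : ι → ℂ) (r : ι → ℝ) : IsCompact (closedPolydisc c r) :=
  isCompact_univ_pi fun i => isCompact_closedBall (c i) (r i)

/-- An open polydisc lies in the closed polydisc of the same radii. [folklore] -/
theorem polydisc_subset_closedPolydisc (c : ι → ℂ) (r : ι → ℝ) : polydisc c r ⊆ closedPolydisc c r :=
  polydisc_subset_pi_closedBall c r

/-- A closed polydisc lies in every open polydisc of larger radii. [folklore] -/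
theorem closedPolydisc_subset_polydisc (c : ι → ℂ) {r r' : ι → ℝ} (h : ∀ i, r i < r' i) :
    closedPolydisc c r ⊆ polydisc c r' :=
  pi_closedBall_subset_polydisc c h

/-- **Analytic polyhedra**: `K = {z ∈ Δ̄(c,r) : |P_j(z)| ≤ 1 ∀ j}` for finitely many functions
`P_j : ℂ^ι → ℂ` (Hörmander (1973), §2.7: polynomial polyhedra, here with entire `P_j`).
[cite: HormanderSCV1973, Lemma 2.7.4] -/
def analyticPolyhedron (c : ι → ℂ) (r : ι → ℝ) {m : ℕ} (P : Fin m → (ι → ℂ) → ℂ) : Set (ι → ℂ) :=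
  {z | z ∈ closedPolydisc c r ∧ ∀ j, ‖P j z‖ ≤ 1}

/-- Membership in an analytic polyhedron. [folklore] -/
theorem mem_analyticPolyhedron {c : ι → ℂ} {r : ι → ℝ} {m : ℕ} {P : Fin m → (ι → ℂ) → ℂ}
    {z : ι → ℂ} : z ∈ analyticPolyhedron c r P ↔ z ∈ closedPolydisc c r ∧ ∀ j, ‖P j z‖ ≤ 1 :=
  Iff.rfl

/-- An analytic polyhedron lies in its closed polydisc. [folklore] -/
theorem analyticPolyhedron_subset_closedPolydisc (c : ι → ℂ) (r : ι → ℝ) {m : ℕ}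
    (P : Fin m → (ι → ℂ) → ℂ) : analyticPolyhedron c r P ⊆ closedPolydisc c r := fun _ hz => hz.1

/-- With no functions the polyhedron is the closed polydisc. [folklore] -/
theorem analyticPolyhedron_zero (c : ι → ℂ) (r : ι → ℝ) (P : Fin 0 → (ι → ℂ) → ℂ) :
    analyticPolyhedron c r P = closedPolydisc c r := by
  ext z
  simp only [mem_analyticPolyhedron, IsEmpty.forall_iff, and_true]

/-- Analytic polyhedra (with continuous functions) are compact. [cite: HormanderSCV1973, §2.7] -/
theorem isCompact_analyticPolyhedron [Fintype ι] (c : ι → ℂ) (r : ι → ℝ) {m : ℕ} {P : Fin m → (ι → ℂ) → ℂ}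
    (hP : ∀ j, Continuous (P j)) : IsCompact (analyticPolyhedron c r P) := by
  have hc : IsClosed {z : ι → ℂ | ∀ j, ‖P j z‖ ≤ 1} := by
    rw [show {z : ι → ℂ | ∀ j, ‖P j z‖ ≤ 1} = ⋂ j, {z | ‖P j z‖ ≤ 1} by ext; simp]
    exact isClosed_iInter fun j => isClosed_le (hP j).norm continuous_const
  exact (isCompact_closedPolydisc c r).inter_right hc

/-- Dropping the last function enlarges the polyhedron. [folklore] -/
theorem analyticPolyhedron_subset_init (c : ι → ℂ) (r : ι → ℝ) {m : ℕ}
    (P : Fin (m + 1) → (ι → ℂ) → ℂ) : analyticPolyhedron c r P ⊆ analyticPolyhedron c r (Fin.init P) :=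
  fun _ hz => ⟨hz.1, fun j => hz.2 (Fin.castSucc j)⟩

/-! ### A neighbourhood of a closed polydisc contains a larger open polydisc -/

/-- If all radii are nonnegative, the open polydisc of radii `r + δ` lies in the `δ`-thickening of
the closed polydisc of radii `r`. [folklore] -/
theorem polydisc_add_subset_thickening [Fintype ι] (c : ι → ℂ) {r : ι → ℝ} (hr : ∀ i, 0 ≤ r i) {δ : ℝ}
    (hδ : 0 < δ) : polydisc c (fun i => r i + δ) ⊆ thickening δ (closedPolydisc c r) := by
  intro z hz
  have h : ∀ i, ∃ w ∈ closedBall (c i) (r i), dist (z i) w < δ := by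
    intro i
    have hzi : z i ∈ thickening δ (closedBall (c i) (r i)) := by
      rw [thickening_closedBall hδ (hr i), add_comm]
      exact mem_polydisc.1 hz i
    exact mem_thickening_iff.1 hzi
  choose w hw hzw using h
  refine mem_thickening_iff.2 ⟨w, fun i _ => hw i, ?_⟩
  exact (dist_pi_lt_iff hδ).2 hzw

/-- **An open neighbourhood of a closed polydisc contains a strictly larger open polydisc**
(compactness). [folklore] -/
theorem exists_polydisc_between [Fintype ι] {c : ι → ℂ} {r : ι → ℝ} (hr : ∀ i, 0 ≤ r i) {U : Set (ι → ℂ)}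
    (hU : IsOpen U) (hKU : closedPolydisc c r ⊆ U) :
    ∃ δ : ℝ, 0 < δ ∧ polydisc c (fun i => r i + δ) ⊆ U := by
  obtain ⟨δ, hδ, hδU⟩ := (isCompact_closedPolydisc c r).exists_thickening_subset_open hU hKU
  exact ⟨δ, hδ, (polydisc_add_subset_thickening c hr hδ).trans hδU⟩

end Defs

/-! ### Smooth cut-offs -/

section Cutoff

variable {X : Type*} [NormedAddCommGroup X] [NormedSpace ℝ X] [FiniteDimensional ℝ X]

/-- **Smooth cut-off functions** (complex-valued): for a compact `K` inside an open `U` of a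
finite-dimensional real normed space there is `χ ∈ C_c^∞(U; ℂ)` with `χ = 1` on a neighbourhood of
`K` (smooth Urysohn lemma, Mathlib's `exists_contMDiffMap_zero_one_nhds_of_isClosed`).
[folklore] -/
theorem exists_complex_cutoff_nhdsSet {K U : Set X} (hK : IsCompact K) (hU : IsOpen U) (hKU : K ⊆ U) :
    ∃ χ : X → ℂ, ContDiff ℝ ∞ χ ∧ HasCompactSupport χ ∧ tsupport χ ⊆ U ∧
      ∃ O : Set X, IsOpen O ∧ K ⊆ O ∧ ∀ x ∈ O, χ x = 1 := by
  obtain ⟨δ, hδ, hδU⟩ := hK.exists_cthickening_subset_open hU hKU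
  have hd : Disjoint (thickening δ K)ᶜ K :=
    disjoint_compl_left.mono_right (self_subset_thickening hδ K)
  obtain ⟨f, hf0, hf1, -⟩ :=
    exists_contMDiffMap_zero_one_nhds_of_isClosed (𝓘(ℝ, X)) (n := (⊤ : ℕ∞))
      isOpen_thickening.isClosed_compl hK.isClosed hd
  have hsupp : support (f : X → ℝ) ⊆ thickening δ K := fun x hx => by
    by_contra hx'
    exact hx (hf0.self_of_nhdsSet x hx')
  have htsupp : tsupport (f : X → ℝ) ⊆ cthickening δ K :=
    (closure_mono hsupp).trans (closure_thickening_subset_cthickening δ K)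
  have hfs : ContDiff ℝ ∞ (f : X → ℝ) := contMDiff_iff_contDiff.1 f.contMDiff
  obtain ⟨O, hOo, hKO, hO1⟩ := mem_nhdsSet_iff_exists.1 hf1
  refine ⟨fun x => ((f x : ℝ) : ℂ), ofRealCLM.contDiff.comp hfs, ?_, ?_, O, hOo, hKO, fun x hx => ?_⟩
  · have hfc : HasCompactSupport (f : X → ℝ) :=
      hK.cthickening.of_isClosed_subset (isClosed_tsupport _) htsupp
    exact hfc.comp_left (g := ((↑) : ℝ → ℂ)) ofReal_zero
  · refine (tsupport_comp_subset ofReal_zero _).trans (htsupp.trans hδU)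
  · have : f x = 1 := hO1 hx
    simp [this]

end Cutoff

/-! ### The passage `ℂ^ι ↔ ℂ^{Option ι}` -/

section Option

variable {ι : Type u}

/-- The projection `ℂ^{Option ι} → ℂ^ι`, `(z, w) ↦ z`, as a function. [folklore] -/
def optProj (y : Option ι → ℂ) : ι → ℂ := fun i => y (some i)

/-- The projection `ℂ^{Option ι} → ℂ^ι` as a continuous complex-linear map. [folklore] -/
def optProjCLM : (Option ι → ℂ) →L[ℂ] (ι → ℂ) :=
  ContinuousLinearMap.pi fun i => ContinuousLinearMap.proj (some i)

/-- Components of `optProj`. [folklore] -/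
@[simp]
theorem optProj_apply (y : Option ι → ℂ) (i : ι) : optProj y i = y (some i) := rfl

/-- `optProjCLM` is `optProj`. [folklore] -/
@[simp]
theorem optProjCLM_apply (y : Option ι → ℂ) : optProjCLM y = optProj y := rfl

/-- `optProjCLM` is `optProj` (as functions). [folklore] -/
theorem coe_optProjCLM : ⇑(optProjCLM (ι := ι)) = optProj := rfl

/-- `optProjCLM` with real scalars is `optProj` (as functions). [folklore] -/
theorem coe_optProjCLM_real : ⇑((optProjCLM (ι := ι)).restrictScalars ℝ) = optProj := rfl

/-- The projection is entire. [folklore] -/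
theorem differentiable_optProj : Differentiable ℂ (optProj (ι := ι)) :=
  (optProjCLM (ι := ι)).differentiable

/-- The projection is real-`C^∞`. [folklore] -/
theorem contDiff_optProj [Fintype ι] : ContDiff ℝ ∞ (optProj (ι := ι)) :=
  ((optProjCLM (ι := ι)).restrictScalars ℝ).contDiff

/-- The real derivative of the projection is the projection. [folklore] -/
theorem fderiv_optProj (y : Option ι → ℂ) :
    fderiv ℝ (optProj (ι := ι)) y = (optProjCLM (ι := ι)).restrictScalars ℝ :=
  ((optProjCLM (ι := ι)).restrictScalars ℝ).fderiv

/-- The graph embedding `ℂ^ι → ℂ^{Option ι}`, `z ↦ (z, P z)`. [cite: HormanderSCV1973, Lemma 2.7.5] -/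
def optEmbed (P : (ι → ℂ) → ℂ) (z : ι → ℂ) : Option ι → ℂ := fun o => o.elim (P z) z

/-- The new coordinate of `optEmbed P z` is `P z`. [folklore] -/
@[simp]
theorem optEmbed_none (P : (ι → ℂ) → ℂ) (z : ι → ℂ) : optEmbed P z none = P z := rfl

/-- The old coordinates of `optEmbed P z` are those of `z`. [folklore] -/
@[simp]
theorem optEmbed_some (P : (ι → ℂ) → ℂ) (z : ι → ℂ) (i : ι) : optEmbed P z (some i) = z i := rfl

/-- `π ∘ Φ = id` pointwise. [folklore] -/
@[simp]
theorem optProj_optEmbed (P : (ι → ℂ) → ℂ) (z : ι → ℂ) : optProj (optEmbed P z) = z := rfl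

/-- `π ∘ Φ = id`. [folklore] -/
theorem optProj_comp_optEmbed (P : (ι → ℂ) → ℂ) : optProj ∘ optEmbed P = id := rfl

/-- The graph embedding of an entire function is entire. [folklore] -/
theorem differentiable_optEmbed [Fintype ι] {P : (ι → ℂ) → ℂ} (hP : Differentiable ℂ P) :
    Differentiable ℂ (optEmbed P) := by
  refine differentiable_pi.2 fun o => ?_
  cases o with
  | none => simpa using hP
  | some i =>
    simp only [optEmbed_some]
    exact differentiable_apply (𝕜 := ℂ) i

/-- The graph embedding of an entire function is real-`C^∞`. [folklore] -/
theorem contDiff_optEmbed [Fintype ι] {P : (ι → ℂ) → ℂ} (hP : Differentiable ℂ P) : ContDiff ℝ ∞ (optEmbed P) :=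
  contDiff_real_of_differentiable (differentiable_optEmbed hP)

/-- `Dπ ∘ DΦ = id` for the graph embedding `Φ` and the projection `π`. [folklore] -/
theorem optProjCLM_comp_fderiv_optEmbed [Fintype ι] {P : (ι → ℂ) → ℂ} (hP : Differentiable ℂ P) (z : ι → ℂ) :
    ((optProjCLM (ι := ι)).restrictScalars ℝ).comp (fderiv ℝ (optEmbed P) z) =
      ContinuousLinearMap.id ℝ (ι → ℂ) := by
  have h1 : HasFDerivAt (optProj ∘ optEmbed P)
      (((optProjCLM (ι := ι)).restrictScalars ℝ).comp (fderiv ℝ (optEmbed P) z)) z :=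
    ((optProjCLM (ι := ι)).restrictScalars ℝ).hasFDerivAt.comp z
      (((contDiff_optEmbed hP).differentiable (by simp)) z).hasFDerivAt
  rw [optProj_comp_optEmbed] at h1
  exact h1.unique (hasFDerivAt_id z)

/-- The lifted polyhedron data on `ℂ^{Option ι}`: centre. [folklore] -/
def optCentre (c : ι → ℂ) : Option ι → ℂ := fun o => o.elim 0 c

/-- The lifted polyhedron data on `ℂ^{Option ι}`: radii (`1` in the new variable). [folklore] -/
def optRadius (r : ι → ℝ) : Option ι → ℝ := fun o => o.elim 1 r

/-- The lifted polyhedron data on `ℂ^{Option ι}`: the first `m` functions, composed with the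
projection. [folklore] -/
def optFun {m : ℕ} (P : Fin (m + 1) → (ι → ℂ) → ℂ) : Fin m → (Option ι → ℂ) → ℂ :=
  fun j y => Fin.init P j (optProj y)

/-- Membership in the lifted polyhedron `Ko = K' × D̄`. [cite: HormanderSCV1973, Lemma 2.7.5] -/
theorem mem_analyticPolyhedron_opt {c : ι → ℂ} {r : ι → ℝ} {m : ℕ} {P : Fin (m + 1) → (ι → ℂ) → ℂ}
    {y : Option ι → ℂ} :
    y ∈ analyticPolyhedron (optCentre c) (optRadius r) (optFun P) ↔
      optProj y ∈ analyticPolyhedron c r (Fin.init P) ∧ ‖y none‖ ≤ 1 := by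
  simp only [mem_analyticPolyhedron, mem_closedPolydisc, Option.forall, optCentre, optRadius,
    Option.elim, sub_zero, optProj_apply, optFun]
  tauto

/-- The graph embedding maps `K` into `Ko`. [cite: HormanderSCV1973, Lemma 2.7.5] -/
theorem optEmbed_mem_analyticPolyhedron_opt {c : ι → ℂ} {r : ι → ℝ} {m : ℕ}
    {P : Fin (m + 1) → (ι → ℂ) → ℂ} {z : ι → ℂ} (hz : z ∈ analyticPolyhedron c r P) :
    optEmbed (P (Fin.last m)) z ∈ analyticPolyhedron (optCentre c) (optRadius r) (optFun P) := by
  rw [mem_analyticPolyhedron_opt, optProj_optEmbed, optEmbed_none]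
  exact ⟨analyticPolyhedron_subset_init c r P hz, hz.2 (Fin.last m)⟩

/-- The lifted functions are entire. [folklore] -/
theorem differentiable_optFun [Fintype ι] {m : ℕ} {P : Fin (m + 1) → (ι → ℂ) → ℂ} (hP : ∀ j, Differentiable ℂ (P j))
    (j : Fin m) : Differentiable ℂ (optFun P j) :=
  (hP (Fin.castSucc j)).comp differentiable_optProj

end Option

/-! ### Oka's transfer step (Hörmander, Lemma 2.7.5) -/

/-- The exterior derivative of the zero form vanishes. [folklore] -/
theorem extDeriv_zero_fun {E F : Type*} [NormedAddCommGroup E] [NormedSpace ℝ E] [NormedAddCommGroup F]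
    [NormedSpace ℝ F] {k : ℕ} (x : E) : extDeriv (fun _ : E => (0 : E [⋀^Fin k]→L[ℝ] F)) x = 0 := by
  simp only [extDeriv, fderiv_const_apply, ← alternatizeUncurryFinCLM_apply, _root_.map_zero]

section Transfer

variable {ι : Type u} [Fintype ι] [DecidableEq ι]

/-- **Oka's transfer to `ℂ^{Option ι}`** (Hörmander (1973), Lemma 2.7.5, flat form, one bidegree).
Let `K = {z ∈ Δ̄ : |P_j z| ≤ 1, j ≤ m}` with last function `P = P_m`, `Ko ⊆ ℂ^{Option ι}` the lifted
polyhedron of the first `m` functions (`K' × D̄`), and assume `∂̄`-solvability near `Ko` in bidegree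
`(p,s+1)` (hypothesis `hsolve`). If `F₁ : ℂ^ι → Λ^N` is `C^∞`, of type `(p,s)`, and `∂̄F₁ = 0` on an
open `O' ⊇ K`, then there are an open `U₁ ⊇ Ko` and `F₂ : ℂ^{Option ι} → Λ^N`, `C^∞` on `U₁`, of type
`(p,s)`, `∂̄`-closed on `U₁`, whose pull-back along the graph `Φ(z) = (z, P z)` is `F₁`:
`F₂ = π^*F₁ - (P(z) - w) v` where `∂̄v = (P(z) - w)⁻¹ π^*∂̄F₁` near `Ko`.
[cite: HormanderSCV1973, Lemma 2.7.5] -/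
theorem oka_transfer (c : ι → ℂ) (r : ι → ℝ) {m : ℕ} (P : Fin (m + 1) → (ι → ℂ) → ℂ)
    (hP : ∀ j, Differentiable ℂ (P j)) {N p s : ℕ} (hdeg : p + s = N)
    (hsolve : ∀ {W : Set (Option ι → ℂ)}, IsOpen W →
      analyticPolyhedron (optCentre c) (optRadius r) (optFun P) ⊆ W →
      ∀ {g : (Option ι → ℂ) → (Option ι → ℂ) [⋀^Fin (N + 1)]→L[ℝ] ℂ}, ContDiffOn ℝ ∞ g W →
        (∀ y ∈ W, IsOfTypeAt p (s + 1) (g y)) → (∀ y ∈ W, typeProjAt p (s + 2) (extDeriv g y) = 0) →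
        ∃ U₁ : Set (Option ι → ℂ), IsOpen U₁ ∧ analyticPolyhedron (optCentre c) (optRadius r) (optFun P) ⊆ U₁ ∧
          U₁ ⊆ W ∧ ∃ v : (Option ι → ℂ) → (Option ι → ℂ) [⋀^Fin N]→L[ℝ] ℂ, ContDiffOn ℝ ∞ v U₁ ∧
            (∀ y, typeProjAt p s (v y) = v y) ∧ ∀ y ∈ U₁, typeProjAt p (s + 1) (extDeriv v y) = g y)
    {F₁ : (ι → ℂ) → (ι → ℂ) [⋀^Fin N]→L[ℝ] ℂ} (hF₁s : ContDiff ℝ ∞ F₁) (hF₁t : ∀ x, IsOfTypeAt p s (F₁ x))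
    {O' : Set (ι → ℂ)} (hO'o : IsOpen O') (hKO' : analyticPolyhedron c r P ⊆ O')
    (hGO : ∀ x ∈ O', typeProjAt p (s + 1) (extDeriv F₁ x) = 0) :
    ∃ U₁ : Set (Option ι → ℂ), IsOpen U₁ ∧ analyticPolyhedron (optCentre c) (optRadius r) (optFun P) ⊆ U₁ ∧
      ∃ F₂ : (Option ι → ℂ) → (Option ι → ℂ) [⋀^Fin N]→L[ℝ] ℂ, ContDiffOn ℝ ∞ F₂ U₁ ∧
        (∀ y, IsOfTypeAt p s (F₂ y)) ∧ (∀ y ∈ U₁, typeProjAt p (s + 1) (extDeriv F₂ y) = 0) ∧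
        ∀ z, flatPullback (optEmbed (P (Fin.last m))) F₂ z = F₁ z := by
  -- the data
  set Pl : (ι → ℂ) → ℂ := P (Fin.last m) with hPl_def
  have hPl : Differentiable ℂ Pl := hP _
  set K : Set (ι → ℂ) := analyticPolyhedron c r P with hK_def
  -- `G = ∂̄F₁` (globally smooth, type `(p,s+1)`, `∂̄`-closed, `= 0` on `O'`)
  set G : (ι → ℂ) → (ι → ℂ) [⋀^Fin (N + 1)]→L[ℝ] ℂ := fun x => typeProjAt p (s + 1) (extDeriv F₁ x)
    with hG_def
  have hGs : ContDiff ℝ ∞ G := contDiff_typeProjAt_extDeriv p (s + 1) hF₁s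
  have hGt : ∀ x, IsOfTypeAt p (s + 1) (G x) := fun x => isOfTypeAt_typeProjAt (by omega) _
  have hGc : ∀ x, typeProjAt p (s + 2) (extDeriv G x) = 0 := fun x => dbar_dbar_eq_zero hF₁t hF₁s x
  -- lift to `ℂ^{Option ι}`
  set h : (Option ι → ℂ) → ℂ := fun y => Pl (optProj y) - y none with hh_def
  have hh : Differentiable ℂ h :=
    (hPl.comp differentiable_optProj).sub (differentiable_apply (𝕜 := ℂ) (none : Option ι))
  have hhs : ContDiff ℝ ∞ h := contDiff_real_of_differentiable hh
  set Go : (Option ι → ℂ) → (Option ι → ℂ) [⋀^Fin (N + 1)]→L[ℝ] ℂ := flatPullback optProj G with hGo_def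
  have hGos : ContDiff ℝ ∞ Go := ContDiff.flatPullback hGs contDiff_optProj
  have hGot : ∀ y, IsOfTypeAt p (s + 1) (Go y) := fun y => (hGt _).flatPullback (differentiable_optProj y)
  have hGoc : ∀ y, typeProjAt p (s + 2) (extDeriv Go y) = 0 := fun y => by
    rw [hGo_def, typeProjAt_extDeriv_flatPullback p (s + 2) ((hGs.differentiable (by simp)) _)
      contDiff_optProj.contDiffAt (differentiable_optProj y), hGc]
    ext v; rfl
  have hGoO : ∀ y, optProj y ∈ O' → Go y = 0 := fun y hy => flatPullback_apply_eq_zero (hGO _ hy)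
  -- the open set `W ⊇ Ko` and the form `g = h⁻¹ Go`
  set W : Set (Option ι → ℂ) := {y | optProj y ∈ O'} ∪ {y | ‖y none‖ < ‖Pl (optProj y)‖} with hW_def
  have hWo : IsOpen W := by
    refine (hO'o.preimage contDiff_optProj.continuous).union ?_
    exact isOpen_lt (continuous_apply none).norm (hPl.continuous.comp contDiff_optProj.continuous).norm
  have hW_of_not : ∀ y ∈ W, optProj y ∉ O' → h y ≠ 0 := by
    rintro y (hy | hy) hyO
    · exact absurd hy hyO
    · intro h0
      have h1 : Pl (optProj y) = y none := sub_eq_zero.1 h0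
      have hy' : ‖y none‖ < ‖Pl (optProj y)‖ := hy
      rw [h1] at hy'
      exact lt_irrefl _ hy'
  set Ko : Set (Option ι → ℂ) := analyticPolyhedron (optCentre c) (optRadius r) (optFun P) with hKo_def
  have hKoW : Ko ⊆ W := by
    intro y hy
    rw [hKo_def, mem_analyticPolyhedron_opt] at hy
    by_cases hyO : optProj y ∈ O'
    · exact Or.inl hyO
    · refine Or.inr (lt_of_le_of_lt hy.2 ?_)
      by_contra hle
      exact hyO (hKO' ⟨hy.1.1, Fin.lastCases (not_lt.1 hle) (fun j => hy.1.2 j)⟩)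
  set g : (Option ι → ℂ) → (Option ι → ℂ) [⋀^Fin (N + 1)]→L[ℝ] ℂ := fun y => (h y)⁻¹ • Go y with hg_def
  have hg_ev : ∀ y, optProj y ∈ O' → g =ᶠ[𝓝 y] fun _ => 0 := fun y hy => by
    filter_upwards [(hO'o.preimage contDiff_optProj.continuous).mem_nhds hy] with y' hy'
    simp only [hg_def, hGoO y' hy']
    ext w; simp
  have hgs : ContDiffOn ℝ ∞ g W := by
    intro y hyW
    by_cases hyO : optProj y ∈ O'
    · exact (contDiffAt_const.congr_of_eventuallyEq (hg_ev y hyO)).contDiffWithinAt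
    · exact ((hhs.contDiffAt.inv (hW_of_not y hyW hyO)).smul hGos.contDiffAt).contDiffWithinAt
  have hgt : ∀ y, IsOfTypeAt p (s + 1) (g y) := fun y => (hGot y).smul _
  have hgc : ∀ y ∈ W, typeProjAt p (s + 2) (extDeriv g y) = 0 := by
    intro y hyW
    by_cases hyO : optProj y ∈ O'
    · rw [(hg_ev y hyO).extDeriv_eq, extDeriv_zero_fun, typeProjAt_zero]
    · exact typeProjAt_extDeriv_smul_eq_zero hGot ((hh y).inv (hW_of_not y hyW hyO))
        ((hGos.differentiable (by simp)) y) (hGoc y)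
  -- solve `∂̄v = g` near `Ko`
  obtain ⟨U₁, hU₁o, hKoU₁, hU₁W, v, hvs, hvt, hvg⟩ := hsolve hWo hKoW hgs (fun y _ => hgt y) hgc
  have hvt' : ∀ y, IsOfTypeAt p s (v y) := fun y => (isOfTypeAt_iff_typeProjAt_eq_self hdeg _).2 (hvt y)
  -- `F₂ = π^*F₁ - h v`
  set F₁o : (Option ι → ℂ) → (Option ι → ℂ) [⋀^Fin N]→L[ℝ] ℂ := flatPullback optProj F₁ with hF₁o_def
  have hF₁os : ContDiff ℝ ∞ F₁o := ContDiff.flatPullback hF₁s contDiff_optProj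
  have hF₁ot : ∀ y, IsOfTypeAt p s (F₁o y) := fun y => (hF₁t _).flatPullback (differentiable_optProj y)
  have hF₁oG : ∀ y, typeProjAt p (s + 1) (extDeriv F₁o y) = Go y := fun y => by
    rw [hF₁o_def, typeProjAt_extDeriv_flatPullback p (s + 1) ((hF₁s.differentiable (by simp)) _)
      contDiff_optProj.contDiffAt (differentiable_optProj y)]
    rfl
  set Hv : (Option ι → ℂ) → (Option ι → ℂ) [⋀^Fin N]→L[ℝ] ℂ := fun y => h y • v y with hHv_def
  set F₂ : (Option ι → ℂ) → (Option ι → ℂ) [⋀^Fin N]→L[ℝ] ℂ := fun y => F₁o y - Hv y with hF₂_def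
  have hHvs : ContDiffOn ℝ ∞ Hv U₁ := hhs.contDiffOn.smul hvs
  have hF₂s : ContDiffOn ℝ ∞ F₂ U₁ := hF₁os.contDiffOn.sub hHvs
  have hF₂t : ∀ y, IsOfTypeAt p s (F₂ y) := fun y => (hF₁ot y).sub ((hvt' y).smul _)
  have hF₂c : ∀ y ∈ U₁, typeProjAt p (s + 1) (extDeriv F₂ y) = 0 := by
    intro y hy
    have hvd : DifferentiableAt ℝ v y := (hvs.contDiffAt (hU₁o.mem_nhds hy)).differentiableAt (by simp)
    have hd1 : DifferentiableAt ℝ F₁o y := (hF₁os.differentiable (by simp)) y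
    have hd2 : DifferentiableAt ℝ Hv y := (hHvs.contDiffAt (hU₁o.mem_nhds hy)).differentiableAt (by simp)
    rw [hF₂_def, extDeriv_sub_apply hd1 hd2, typeProjAt_sub, hF₁oG, hHv_def,
      typeProjAt_extDeriv_smul_of_differentiableAt hvt' (hh y) hvd, hvg y hy, hg_def]
    by_cases h0 : h y = 0
    · have hyO : optProj y ∈ O' := by
        by_contra hyO
        exact hW_of_not y (hU₁W hy) hyO h0
      ext w; simp [h0, hGoO y hyO]
    · ext w; simp [h0]
  -- the pull-back along the graph
  have hhΦ : ∀ z, h (optEmbed Pl z) = 0 := fun z => by simp [hh_def, hPl_def]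
  refine ⟨U₁, hU₁o, hKoU₁, F₂, hF₂s, hF₂t, hF₂c, fun z => ?_⟩
  have h1 : F₂ (optEmbed Pl z) = F₁o (optEmbed Pl z) := by
    simp only [hF₂_def, hHv_def, hhΦ z]
    ext w; simp
  rw [flatPullback_apply, h1, hF₁o_def, flatPullback_apply, compContinuousLinearMap_compContinuousLinearMap,
    fderiv_optProj, optProjCLM_comp_fderiv_optEmbed hPl, compContinuousLinearMap_id', optProj_optEmbed]

end Transfer

/-! ### Oka's lemma -/

/-- **Oka's lemma: `∂̄`-solvability near analytic polyhedra** (Hörmander (1973), Thm. 2.7.6 (a)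
with Lemma 2.7.5, for polyhedra defined by entire functions; flat `(p,q)`-calculus). For every
analytic polyhedron `K = {z ∈ Δ̄(c,r) : |P_j z| ≤ 1}` of `ℂ^ι` (`P_j` entire), every open
`U ⊇ K` and every `f : ℂ^ι → Λ^{n+1}`, `C^∞` on `U`, of type `(p,q+1)` on `U` with
`(df)^{p,q+2} = 0` on `U`, there are an open `U'`, `K ⊆ U' ⊆ U`, and `u : ℂ^ι → Λ^n`, `C^∞` on
`U'`, fixed by the `(p,q)`-projection, with `(du)^{p,q+1} = f` on `U'`. (Induction on the number
of functions through `ℂ^{Option ι}`; see the module docstring.) [cite: HormanderSCV1973, Thm. 2.7.6] -/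
theorem exists_dbar_potential_nhds_analyticPolyhedron :
    ∀ (m : ℕ) {ι : Type u} [Fintype ι] [DecidableEq ι] (c : ι → ℂ) (r : ι → ℝ)
      (P : Fin m → (ι → ℂ) → ℂ) (_hP : ∀ j, Differentiable ℂ (P j)) {n p q : ℕ} {U : Set (ι → ℂ)}
      (_hU : IsOpen U) (_hKU : analyticPolyhedron c r P ⊆ U)
      {f : (ι → ℂ) → (ι → ℂ) [⋀^Fin (n + 1)]→L[ℝ] ℂ} (_hf : ContDiffOn ℝ ∞ f U)
      (_hft : ∀ x ∈ U, IsOfTypeAt p (q + 1) (f x))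
      (_hfc : ∀ x ∈ U, typeProjAt p (q + 2) (extDeriv f x) = 0),
      ∃ U' : Set (ι → ℂ), IsOpen U' ∧ analyticPolyhedron c r P ⊆ U' ∧ U' ⊆ U ∧
        ∃ u : (ι → ℂ) → (ι → ℂ) [⋀^Fin n]→L[ℝ] ℂ, ContDiffOn ℝ ∞ u U' ∧
          (∀ x, typeProjAt p q (u x) = u x) ∧ ∀ x ∈ U', typeProjAt p (q + 1) (extDeriv u x) = f x := by
  intro m
  induction m with
  | zero =>
    intro ι _ _ c r P hP n p q U hU hKU f hf hft hfc
    rw [analyticPolyhedron_zero] at hKU ⊢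
    by_cases hr : ∀ i, 0 ≤ r i
    · -- a larger open polydisc inside `U`, then the polydisc lemma with shrinking
      obtain ⟨δ, hδ, hδU⟩ := exists_polydisc_between hr hU hKU
      have h1 : ∀ i, r i + δ / 2 < r i + δ := fun i => by linarith
      obtain ⟨β, hβs, hβt, hβf⟩ := exists_dbar_potential_of_type (c := c) (p := p) (q := q) h1
        (hf.mono hδU) (fun x hx => hft x (hδU hx)) (fun x hx => hfc x (hδU hx))
      refine ⟨polydisc c fun i => r i + δ / 2, isOpen_polydisc _ _,
        closedPolydisc_subset_polydisc c fun i => by linarith,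
        (polydisc_mono c fun i => (h1 i).le).trans hδU, β, hβs.contDiffOn, hβt, hβf⟩
    · -- empty closed polydisc
      obtain ⟨i, hi⟩ := not_forall.1 hr
      have hempty : closedPolydisc c r = ∅ := by
        refine Set.eq_empty_of_forall_notMem fun z hz => hi ?_
        exact (norm_nonneg _).trans (mem_closedPolydisc.1 hz i)
      refine ⟨∅, isOpen_empty, hempty.le, empty_subset _, 0, contDiffOn_const, fun x => by simp,
        fun x hx => hx.elim⟩
  | succ m ih =>
    intro ι _ _ c r P hP n p q U hU hKU f hf hft hfc
    set K : Set (ι → ℂ) := analyticPolyhedron c r P with hK_def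
    have hKc : IsCompact K := isCompact_analyticPolyhedron c r fun j => (hP j).continuous
    -- the empty case, and the degree
    rcases K.eq_empty_or_nonempty with hKe | ⟨x₀, hx₀⟩
    · refine ⟨∅, isOpen_empty, hKe.le, empty_subset _, 0, contDiffOn_const, fun x => by simp,
        fun x hx => hx.elim⟩
    have hdeg : p + (q + 1) = n + 1 := (hft x₀ (hKU hx₀)).1
    -- cut-off `χ = 1` on the open `O' ⊇ K`, `supp χ ⊆ U`; `F₁ = χ f`
    obtain ⟨χ, hχs, -, hχU, O, hOo, hKO, hO1⟩ := exists_complex_cutoff_nhdsSet hKc hU hKU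
    set O' : Set (ι → ℂ) := O ∩ U with hO'_def
    have hO'o : IsOpen O' := hOo.inter hU
    have hKO' : K ⊆ O' := subset_inter hKO hKU
    set F₁ : (ι → ℂ) → (ι → ℂ) [⋀^Fin (n + 1)]→L[ℝ] ℂ := fun x => χ x • typeProjAt p (q + 1) (f x)
      with hF₁_def
    have hF₁s : ContDiff ℝ ∞ F₁ :=
      contDiff_smul_of_tsupport_subset hU hχs hχU
        (((typeProjL (E := ι → ℂ) (k := n + 1) p (q + 1)).restrictScalars ℝ).contDiff.comp_contDiffOn hf)
    have hF₁t : ∀ x, IsOfTypeAt p (q + 1) (F₁ x) := fun x => (isOfTypeAt_typeProjAt hdeg _).smul _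
    have hF₁f : ∀ x ∈ O', F₁ x = f x := fun x hx => by
      simp only [hF₁_def, hO1 x hx.1, one_smul, (hft x hx.2).typeProjAt_eq_self]
    have hGO : ∀ x ∈ O', typeProjAt p (q + 2) (extDeriv F₁ x) = 0 := fun x hx => by
      rw [(Filter.eventuallyEq_of_mem (hO'o.mem_nhds hx) hF₁f).extDeriv_eq, hfc x hx.2]
    -- Oka's transfer (induction hypothesis in bidegree `(p,q+2)` on `ℂ^{Option ι}`)
    have hPo : ∀ j, Differentiable ℂ (optFun P j) := differentiable_optFun hP
    obtain ⟨U₁, hU₁o, hKoU₁, F₂, hF₂s, hF₂t, hF₂c, hF₂F₁⟩ :=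
      oka_transfer c r P hP (N := n + 1) (p := p) (s := q + 1) hdeg
        (fun {W} hWo hKoW {g} hgs hgt hgc => ih (optCentre c) (optRadius r) (optFun P) hPo hWo hKoW hgs hgt hgc)
        hF₁s hF₁t hO'o hKO' hGO
    -- induction hypothesis in bidegree `(p,q+1)`: `∂̄V = F₂` near `Ko`
    obtain ⟨U₂, hU₂o, hKoU₂, hU₂U₁, V, hVs, hVt, hVF⟩ :=
      ih (optCentre c) (optRadius r) (optFun P) hPo (n := n) (p := p) (q := q) hU₁o hKoU₁ hF₂s
        (fun y _ => hF₂t y) hF₂c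
    -- pull back along the graph `Φ z = (z, P z)`
    set Φ : (ι → ℂ) → (Option ι → ℂ) := optEmbed (P (Fin.last m)) with hΦ_def
    have hΦ : Differentiable ℂ Φ := differentiable_optEmbed (hP _)
    have hΦs : ContDiff ℝ ∞ Φ := contDiff_optEmbed (hP _)
    have hΦK : ∀ z ∈ K, Φ z ∈ analyticPolyhedron (optCentre c) (optRadius r) (optFun P) := fun z hz =>
      optEmbed_mem_analyticPolyhedron_opt hz
    set U' : Set (ι → ℂ) := Φ ⁻¹' U₂ ∩ O' with hU'_def
    have hU'o : IsOpen U' := (hU₂o.preimage hΦs.continuous).inter hO'o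
    refine ⟨U', hU'o, fun z hz => ⟨hKoU₂ (hΦK z hz), hKO' hz⟩, inter_subset_right.trans inter_subset_right,
      flatPullback Φ V, (ContDiffOn.flatPullback hVs hU₂o hΦs).mono inter_subset_left, fun z => ?_,
      fun z hz => ?_⟩
    · exact typeProjAt_flatPullback_eq_self (hVt _) (hΦ z)
    · have hVd : DifferentiableAt ℝ V (Φ z) :=
        (hVs.contDiffAt (hU₂o.mem_nhds hz.1)).differentiableAt (by simp)
      rw [typeProjAt_extDeriv_flatPullback p (q + 1) hVd hΦs.contDiffAt (hΦ z), hVF (Φ z) hz.1,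
        ← flatPullback_apply, hΦ_def, hF₂F₁ z]
      exact hF₁f z hz.2

/-- **Global `C^∞` potentials with `∂̄u = f` near an analytic polyhedron** (Hörmander (1973),
Thm. 2.7.6 (a), globalised by a cut-off): in the situation of
`exists_dbar_potential_nhds_analyticPolyhedron` there is `u : ℂ^ι → Λ^n`, `C^∞` on all of `ℂ^ι`,
fixed by the `(p,q)`-projection, with `(du)^{p,q+1} = f` on a neighbourhood of `K`.
[cite: HormanderSCV1973, Thm. 2.7.6] -/
theorem exists_dbar_potential_nhdsSet_analyticPolyhedron {ι : Type u} [Fintype ι] [DecidableEq ι]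
    (c : ι → ℂ) (r : ι → ℝ) {m : ℕ} (P : Fin m → (ι → ℂ) → ℂ) (hP : ∀ j, Differentiable ℂ (P j))
    {n p q : ℕ} {U : Set (ι → ℂ)} (hU : IsOpen U) (hKU : analyticPolyhedron c r P ⊆ U)
    {f : (ι → ℂ) → (ι → ℂ) [⋀^Fin (n + 1)]→L[ℝ] ℂ} (hf : ContDiffOn ℝ ∞ f U)
    (hft : ∀ x ∈ U, IsOfTypeAt p (q + 1) (f x)) (hfc : ∀ x ∈ U, typeProjAt p (q + 2) (extDeriv f x) = 0) :
    ∃ u : (ι → ℂ) → (ι → ℂ) [⋀^Fin n]→L[ℝ] ℂ, ContDiff ℝ ∞ u ∧ (∀ x, typeProjAt p q (u x) = u x) ∧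
      ∀ᶠ x in 𝓝ˢ (analyticPolyhedron c r P), typeProjAt p (q + 1) (extDeriv u x) = f x := by
  obtain ⟨U', hU'o, hKU', -, u, hus, hut, huf⟩ :=
    exists_dbar_potential_nhds_analyticPolyhedron m c r P hP hU hKU hf hft hfc
  have hKc : IsCompact (analyticPolyhedron c r P) :=
    isCompact_analyticPolyhedron c r fun j => (hP j).continuous
  obtain ⟨χ, hχs, -, hχU', O, hOo, hKO, hO1⟩ := exists_complex_cutoff_nhdsSet hKc hU'o hKU'
  refine ⟨fun x => χ x • u x, contDiff_smul_of_tsupport_subset hU'o hχs hχU' hus, fun x => by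
    rw [typeProjAt_smul, hut], ?_⟩
  rw [eventually_nhdsSet_iff_exists]
  refine ⟨O ∩ U', hOo.inter hU'o, subset_inter hKO hKU', fun x hx => ?_⟩
  have hev : (fun y => χ y • u y) =ᶠ[𝓝 x] u := by
    filter_upwards [(hOo.inter hU'o).mem_nhds hx] with y hy
    rw [hO1 y hy.1, one_smul]
  rw [hev.extDeriv_eq, huf x hx.2]

end Literature.Analysis.Complex
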